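import Literature.MathematicalPhysics.QuantumFieldTheory.Balaban1983to89.Beta.KKTFluctuationKernel
import Literature.MathematicalPhysics.QuantumFieldTheory.Balaban1983to89.Beta.FibreLiouville

/-!
# `Balaban1983to89.Beta.KKTFluctuationUnique` — UNIQUENESS OF TEMPERED SOLUTIONS of the `U = 1` gauge-fixed
block-averaging KKT system on `ℤ^{d+1}`: the fluctuation covariance kernel `Γ_N` of `Beta/KKTFluctuationKernel` and the
minimiser columns `H_N` of `Beta/KernelSpecInstance` are THE unique polynomially bounded solutions of their systems
(β sub-cell row BETA-an2, unit `b2b-balaban-beta-an2` gen 6; brick (Γ-uniq) of AN2.md §13.3 / §14)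

HONEST FRAMING (cell `pub-balaban`, BETA-SPEC, verbatim): discharging `BetaPertH` makes Bałaban's UV stability
UNCONDITIONAL — a real constructive-QFT result; it is NOT the continuum limit and NOT the Clay problem.  This module is
[folklore] lattice linear algebra at `U = 1`; it asserts NOTHING about Bałaban's β-function (1.22), contains no
`def … : Prop` fact, cites no theorem as a hypothesis, and is NOT summit progress.

ABSOLUTE RULE (cell, verbatim): no internally-minted statement may enter as a cited fact; every hypothesis is either
kernel-proved in this package or a verbatim quotation of a PUBLISHED theorem with page reference; the manuscripts under
audit are NOT citable for their own disputed steps.  Nothing below is cited; everything is proved.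

WHAT IS PROVED.  Fix `N ≥ 1` and `d`.  Say a real triple `(A, φ, μ)` (fine 1-form, coarse 1-form, fine 0-form on
`ℤ^{d+1}`) SOLVES THE KKT SYSTEM WITH FORCE `F` AND AVERAGES `c` (`SolvesKKT N F c A φ μ`) if
    (EL) `curvAdj (curv A) = 𝒬ᵀ_N φ + d δ d μ + F`,   (G) `δ d δ A` is block-constant (`IsBlockConst N`),
    (M)  every block sum of `μ` vanishes,              (Q) `contourSum N A = c`,
and call a field TEMPERED if it is `O((1 + |x|₁)^m)` (`Tempered0`, `Tempered1`).
§1–§3  A real triple is packaged as a block configuration `cfgOf A φ μ : BlochFibreMatrix.Cfg (d+1) N` whose fields read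
       back are `A, φ, μ` (`cfgA_cfgOf`, …); the lattice operators commute with `ℝ ↪ ℂ` (`curv_ofR1`, …); the block
       residual of `cfgOf A φ μ` is computed from the real fields (`resid_cfgOf_*`), hence from `(F, c)` alone for a
       solution (`cfgFun_cfgOf_of_solvesKKT`); tempered triples give polynomially bounded configurations
       (`polyBdd_cfgOf`, using `KernelSpecInstance.l1_le_l1_quo`).
§4     **UNIQUENESS** `unique_of_solvesKKT`: two TEMPERED triples solving the system with the SAME `(F, c)` are equal —
       by `FibreLiouville.eq_of_stencilApply_eq` (polynomial Liouville for the block operator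
       `stencilApply (stencil (d+1)) pieceMatrix = cfgFun ∘ shiftCfg`, `BlochFibreMatrix.cfgFun_shiftCfg_eq_sum`) and the
       nonsingularity of every real Bloch fibre (`BlochFibreMatrix.det_trigPolySymbol_ne_zero`).
§5     **THE FLUCTUATION COVARIANCE KERNEL IS CANONICAL** `eq_Gam_of_solvesKKT`: a tempered triple solving the system
       with the unit force `δ_{(l, x')}` and zero averages IS `(Γ(·, (l, x')), Φ(·, (l, x')), M(·, (l, x')))` of
       `Beta/KKTFluctuationKernel` (`solvesKKT_Gam`, `tempered_Gam*` from `decay_*`).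
§6     **THE MINIMISER COLUMNS ARE CANONICAL** `eq_wH_of_solvesKKT`: a tempered triple solving the force-free system with
       averages `δ_{κ l} δ_{y 0}` IS the column `(wH(·, l, ·), wΦ(·, l, ·), wM l)` of `Beta/KernelSpecInstance`
       (`solvesKKT_wH`, with the block-sum identity `wM_M` read back from `KKTFluctuationKernel.fundCfg_M`).
No sorry, no new axioms, no cited facts; everything at FIXED `N` (no uniformity in `N` is claimed or needed).

WHY (markdown AN2.md §14; BETA-SPEC §7.31 (e); dead line «sector-by-sector matching of Feynman-gauge tables with
Landau/axial legs → representation-dependent»).  Uniqueness is the representation-independence lever for (D1-rep): ANY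
construction of the `U = 1` one-step fluctuation covariance with polynomial bounds that satisfies the four identities —
a torus/thermodynamic limit, a projection formula `G₁𝒫` in another gauge bookkeeping, an1's tables — coincides with the
typed `Γ_N`; only the four identities have to be checked, never a formula-by-formula dictionary.

READING (markdown only, never cited; DIVERGENCE D-an2.15).  In print uniqueness is implicit in «the usual Lagrange
function argument» / positivity of the quadratic form on the constraint surface ([Balaban1985BackgroundPropagators]
p. 425–426 (3.147)–(3.153); [Balaban1984PropagatorsI] p. 34–35 (1.104)–(1.107)) on a FINITE torus or Dirichlet domain;
the typed statement is on `ℤ^{d+1}` in the tempered class, where positivity is replaced by the empty real Fermi surface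
(`det_trigPolySymbol_ne_zero`) and the Floquet–Liouville principle ([KuchmentPinchover2007] Thm 7.1, context only, as in
`Beta/FibreLiouville`).
-/

namespace Literature.MathematicalPhysics.QuantumFieldTheory.Balaban1983to89.Beta.KKTFluctuationUnique

noncomputable section

open Literature.Probability.LatticeModels (TorusSite Torus.proj Torus.proj_apply)
open AffineAveraging (Form0 Form1 Form2 unitVec unitVec_apply dz curv curvAdj codiff₁ box toSite blockSum
  contourSum)
open AffineReproduction (contourSumAdj IsBlockConst)
open LatticeForm (repZ quo proj_repZ)
open BlochFibreUniqueness (adjContourSum adjContourSum_apply quo_add_zsmul quo_repZ repZ_eq_toSite)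
open BlochFibreMatrix (Idx Cfg cfgA cfgμ cfgφ cfgFun shiftCfg stencil pieceMatrix fundCfg eq_repZ_add_zsmul_quo
  cfgFun_shiftCfg_eq_sum cfgFun_shiftCfg_inl cfgFun_shiftCfg_inr_inl cfgFun_shiftCfg_inr_inr det_trigPolySymbol_ne_zero)
open FibreLiouville (PolyBdd stencilApply eq_of_stencilApply_eq one_le_one_add_l1)
open KernelSpecInstance (re0 re1 re0_apply re1_apply src colμ wH wΦ wM wH_EL wH_G wH_Q decay_wH decay_wM decay_wΦ
  l1_le_l1_quo)
open KKTFluctuationKernel (Gam GamΦ GamM wΓφ wΓμ delta1 delta1_apply Gam_EL Gam_G GamM_M Gam_Q decay_Gam decay_wΓμ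
  decay_wΓφ fundCfg_M)
open B12Sec2to5 (l1 l1_nonneg Decay510)

variable {d N : ℕ}

/-! ## §1 Real field triples as block configurations -/

section Embed

variable [NeZero N]

/-- THE BLOCK CONFIGURATION OF A REAL FIELD TRIPLE `(A, φ, μ)`: block `y` carries the values of `A` and `μ` on the box of
block `y` and the value of `φ` at `y`, as complex numbers. [folklore] -/
def cfgOf (A φ : Form1 (d + 1) ℝ) (μ : Form0 (d + 1) ℝ) : Cfg (d + 1) N := fun y i =>
  match i with
  | Sum.inl (κ, z) => ((A κ (repZ z + (N : ℤ) • y) : ℝ) : ℂ)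
  | Sum.inr (Sum.inl z) => ((μ (repZ z + (N : ℤ) • y) : ℝ) : ℂ)
  | Sum.inr (Sum.inr κ) => ((φ κ y : ℝ) : ℂ)

omit [NeZero N] in
/-- EL-row entries of `cfgOf`. [folklore] -/
@[simp] theorem cfgOf_inl (A φ : Form1 (d + 1) ℝ) (μ : Form0 (d + 1) ℝ) (y : AffineAveraging.Site (d + 1))
    (κ : Fin (d + 1)) (z : TorusSite (d + 1) N) :
    cfgOf (N := N) A φ μ y (Sum.inl (κ, z)) = ((A κ (repZ z + (N : ℤ) • y) : ℝ) : ℂ) := rfl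

omit [NeZero N] in
/-- G/M-row entries of `cfgOf`. [folklore] -/
@[simp] theorem cfgOf_inr_inl (A φ : Form1 (d + 1) ℝ) (μ : Form0 (d + 1) ℝ) (y : AffineAveraging.Site (d + 1))
    (z : TorusSite (d + 1) N) :
    cfgOf (N := N) A φ μ y (Sum.inr (Sum.inl z)) = ((μ (repZ z + (N : ℤ) • y) : ℝ) : ℂ) := rfl

omit [NeZero N] in
/-- Q-row entries of `cfgOf`. [folklore] -/
@[simp] theorem cfgOf_inr_inr (A φ : Form1 (d + 1) ℝ) (μ : Form0 (d + 1) ℝ) (y : AffineAveraging.Site (d + 1))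
    (κ : Fin (d + 1)) :
    cfgOf (N := N) A φ μ y (Sum.inr (Sum.inr κ)) = ((φ κ y : ℝ) : ℂ) := rfl

/-- `ℝ ↪ ℂ` on 0-forms. [folklore] -/
def ofR0 (f : Form0 (d + 1) ℝ) : Form0 (d + 1) ℂ := fun x => ((f x : ℝ) : ℂ)

/-- `ℝ ↪ ℂ` on 1-forms. [folklore] -/
def ofR1 (A : Form1 (d + 1) ℝ) : Form1 (d + 1) ℂ := fun κ x => ((A κ x : ℝ) : ℂ)

/-- `ℝ ↪ ℂ` on 2-forms. [folklore] -/
def ofR2 (F : Form2 (d + 1) ℝ) : Form2 (d + 1) ℂ := fun κ l x => ((F κ l x : ℝ) : ℂ)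

omit [NeZero N] in
/-- Entries of `ofR0`. [folklore] -/
@[simp] theorem ofR0_apply (f : Form0 (d + 1) ℝ) (x : AffineAveraging.Site (d + 1)) : ofR0 f x = ((f x : ℝ) : ℂ) := rfl

omit [NeZero N] in
/-- Entries of `ofR1`. [folklore] -/
@[simp] theorem ofR1_apply (A : Form1 (d + 1) ℝ) (κ : Fin (d + 1)) (x : AffineAveraging.Site (d + 1)) :
    ofR1 A κ x = ((A κ x : ℝ) : ℂ) := rfl

omit [NeZero N] in
/-- Entries of `ofR2`. [folklore] -/
@[simp] theorem ofR2_apply (F : Form2 (d + 1) ℝ) (κ l : Fin (d + 1)) (x : AffineAveraging.Site (d + 1)) :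
    ofR2 F κ l x = ((F κ l x : ℝ) : ℂ) := rfl

/-- The fine 1-form read back from `cfgOf A φ μ` is `A`. [folklore] -/
theorem cfgA_cfgOf (A φ : Form1 (d + 1) ℝ) (μ : Form0 (d + 1) ℝ) : cfgA (cfgOf (N := N) A φ μ) = ofR1 A := by
  funext κ x
  show ((A κ (repZ (Torus.proj N x) + (N : ℤ) • quo N x) : ℝ) : ℂ) = ((A κ x : ℝ) : ℂ)
  rw [← eq_repZ_add_zsmul_quo]

/-- The fine 0-form read back from `cfgOf A φ μ` is `μ`. [folklore] -/
theorem cfgμ_cfgOf (A φ : Form1 (d + 1) ℝ) (μ : Form0 (d + 1) ℝ) : cfgμ (cfgOf (N := N) A φ μ) = ofR0 μ := by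
  funext x
  show ((μ (repZ (Torus.proj N x) + (N : ℤ) • quo N x) : ℝ) : ℂ) = ((μ x : ℝ) : ℂ)
  rw [← eq_repZ_add_zsmul_quo]

omit [NeZero N] in
/-- The coarse 1-form read back from `cfgOf A φ μ` is `φ`. [folklore] -/
theorem cfgφ_cfgOf (A φ : Form1 (d + 1) ℝ) (μ : Form0 (d + 1) ℝ) : cfgφ (cfgOf (N := N) A φ μ) = ofR1 φ := rfl

/-- Two real triples with the same configuration are equal. [folklore] -/
theorem eq_of_cfgOf_eq {A φ A' φ' : Form1 (d + 1) ℝ} {μ μ' : Form0 (d + 1) ℝ}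
    (h : cfgOf (N := N) A φ μ = cfgOf (N := N) A' φ' μ') : A = A' ∧ φ = φ' ∧ μ = μ' := by
  refine ⟨?_, ?_, ?_⟩
  · funext κ x
    have e := congr_fun (congr_fun (congrArg cfgA h) κ) x
    rw [cfgA_cfgOf, cfgA_cfgOf, ofR1_apply, ofR1_apply] at e
    exact_mod_cast e
  · funext κ y
    have e := congr_fun (congr_fun h y) (Sum.inr (Sum.inr κ))
    rw [cfgOf_inr_inr, cfgOf_inr_inr] at e
    exact_mod_cast e
  · funext x
    have e := congr_fun (congrArg cfgμ h) x
    rw [cfgμ_cfgOf, cfgμ_cfgOf, ofR0_apply, ofR0_apply] at e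
    exact_mod_cast e

end Embed

/-! ## §2 The lattice operators commute with `ℝ ↪ ℂ` -/

section OfReal

/-- `dz` commutes with `ℝ ↪ ℂ`. [folklore] -/
theorem dz_ofR0 (f : Form0 (d + 1) ℝ) : dz (ofR0 f) = ofR1 (dz f) := by
  funext κ x; simp [dz]

/-- `curv` commutes with `ℝ ↪ ℂ`. [folklore] -/
theorem curv_ofR1 (A : Form1 (d + 1) ℝ) : curv (ofR1 A) = ofR2 (curv A) := by
  funext κ l x; simp [curv]

/-- `curvAdj` commutes with `ℝ ↪ ℂ`. [folklore] -/
theorem curvAdj_ofR2 (F : Form2 (d + 1) ℝ) : curvAdj (ofR2 F) = ofR1 (curvAdj F) := by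
  funext κ x; simp [curvAdj]

/-- `codiff₁` commutes with `ℝ ↪ ℂ`. [folklore] -/
theorem codiff₁_ofR1 (A : Form1 (d + 1) ℝ) : codiff₁ (ofR1 A) = ofR0 (codiff₁ A) := by
  funext x; simp [codiff₁]

/-- `𝒬ᵀ_N` commutes with `ℝ ↪ ℂ` (complex `adjContourSum` of a real coarse form is the real `contourSumAdj`). [folklore] -/
theorem adjContourSum_ofR1 (φ : Form1 (d + 1) ℝ) : adjContourSum N (ofR1 φ) = ofR1 (contourSumAdj N φ) := by
  funext κ x; simp [adjContourSum, contourSumAdj]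

/-- `contourSum N` commutes with `ℝ ↪ ℂ`. [folklore] -/
theorem contourSum_ofR1 (A : Form1 (d + 1) ℝ) : contourSum N (ofR1 A) = ofR1 (contourSum N A) := by
  funext κ x; simp [contourSum]

/-- `blockSum N` commutes with `ℝ ↪ ℂ`. [folklore] -/
theorem blockSum_ofR0 (f : Form0 (d + 1) ℝ) : blockSum N (ofR0 f) = ofR0 (blockSum N f) := by
  funext x; simp [blockSum]

end OfReal

/-! ## §3 The KKT system with force `F` and averages `c`; the residual of a solution; temperedness -/

/-- `(A, φ, μ)` SOLVES THE `U = 1` GAUGE-FIXED BLOCK-AVERAGING KKT SYSTEM on `ℤ^{d+1}` with FORCE `F` on the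
Euler–Lagrange rows and prescribed BLOCK AVERAGES `c`: (EL) `d*d A = 𝒬ᵀ_N φ + d δ d μ + F`, (G) the gauge quantity
`δ d δ A` is block-constant, (M) `μ` has zero block sums, (Q) `contourSum N A = c`. [folklore] -/
structure SolvesKKT (N : ℕ) (F c A φ : Form1 (d + 1) ℝ) (μ : Form0 (d + 1) ℝ) : Prop where
  el : ∀ (κ : Fin (d + 1)) (x : AffineAveraging.Site (d + 1)),
    curvAdj (curv A) κ x = contourSumAdj N φ κ x + dz (codiff₁ (dz μ)) κ x + F κ x
  gauge : IsBlockConst N (codiff₁ (dz (codiff₁ A)))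
  mean : ∀ y : AffineAveraging.Site (d + 1), blockSum N μ y = 0
  avg : ∀ (κ : Fin (d + 1)) (y : AffineAveraging.Site (d + 1)), contourSum N A κ y = c κ y

/-- TEMPERED (polynomially bounded) 0-forms. [folklore] -/
def Tempered0 (f : Form0 (d + 1) ℝ) : Prop := ∃ C : ℝ, ∃ m : ℕ, ∀ x, |f x| ≤ C * (1 + l1 x) ^ m

/-- TEMPERED (polynomially bounded) 1-forms. [folklore] -/
def Tempered1 (A : Form1 (d + 1) ℝ) : Prop := ∃ C : ℝ, ∃ m : ℕ, ∀ κ x, |A κ x| ≤ C * (1 + l1 x) ^ m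

/-- Bounded 0-forms are tempered. [folklore] -/
theorem Tempered0.of_bounded {f : Form0 (d + 1) ℝ} {B : ℝ} (h : ∀ x, |f x| ≤ B) : Tempered0 f :=
  ⟨B, 0, fun x => by rw [pow_zero, mul_one]; exact h x⟩

/-- Bounded 1-forms are tempered. [folklore] -/
theorem Tempered1.of_bounded {A : Form1 (d + 1) ℝ} {B : ℝ} (h : ∀ κ x, |A κ x| ≤ B) : Tempered1 A :=
  ⟨B, 0, fun κ x => by rw [pow_zero, mul_one]; exact h κ x⟩

section Residual

variable [NeZero N]

/-- EL rows of the block residual of `cfgOf A φ μ`, from the real fields. [folklore] -/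
theorem resid_cfgOf_inl (A φ : Form1 (d + 1) ℝ) (μ : Form0 (d + 1) ℝ) (y : AffineAveraging.Site (d + 1))
    (κ : Fin (d + 1)) (z : TorusSite (d + 1) N) :
    cfgFun (shiftCfg (cfgOf (N := N) A φ μ) y) (Sum.inl (κ, z))
      = (((curvAdj (curv A) κ (repZ z + (N : ℤ) • y) - contourSumAdj N φ κ (repZ z + (N : ℤ) • y)
          - dz (codiff₁ (dz μ)) κ (repZ z + (N : ℤ) • y) : ℝ)) : ℂ) := by
  rw [cfgFun_shiftCfg_inl, cfgA_cfgOf, cfgφ_cfgOf, cfgμ_cfgOf, curv_ofR1, curvAdj_ofR2, adjContourSum_ofR1, dz_ofR0,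
    codiff₁_ofR1, dz_ofR0]
  simp only [ofR1_apply]
  push_cast
  ring

/-- G / M rows of the block residual of `cfgOf A φ μ`, from the real fields. [folklore] -/
theorem resid_cfgOf_inr_inl (A φ : Form1 (d + 1) ℝ) (μ : Form0 (d + 1) ℝ) (y : AffineAveraging.Site (d + 1))
    (z : TorusSite (d + 1) N) :
    cfgFun (shiftCfg (cfgOf (N := N) A φ μ) y) (Sum.inr (Sum.inl z))
      = if z = 0 then (((blockSum N μ y : ℝ)) : ℂ)
        else (((codiff₁ (dz (codiff₁ A)) (repZ z + (N : ℤ) • y) - codiff₁ (dz (codiff₁ A)) ((N : ℤ) • y) : ℝ)) : ℂ) := by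
  rw [cfgFun_shiftCfg_inr_inl, cfgA_cfgOf, cfgμ_cfgOf, blockSum_ofR0, codiff₁_ofR1, dz_ofR0, codiff₁_ofR1]
  simp only [ofR0_apply]
  push_cast
  rfl

/-- Q rows of the block residual of `cfgOf A φ μ`, from the real fields. [folklore] -/
theorem resid_cfgOf_inr_inr (A φ : Form1 (d + 1) ℝ) (μ : Form0 (d + 1) ℝ) (y : AffineAveraging.Site (d + 1))
    (κ : Fin (d + 1)) :
    cfgFun (shiftCfg (cfgOf (N := N) A φ μ) y) (Sum.inr (Sum.inr κ)) = (((contourSum N A κ y : ℝ)) : ℂ) := by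
  rw [cfgFun_shiftCfg_inr_inr, cfgA_cfgOf, contourSum_ofR1, ofR1_apply]

/-- Every residue `z` is the residue of a box point: `repZ z = toSite b` with `b ∈ box`. [folklore] -/
theorem repZ_mem_box (z : TorusSite (d + 1) N) : (fun j => (z j).val) ∈ box (d + 1) N := by
  simp only [AffineAveraging.box, Fintype.mem_piFinset, Finset.mem_range]
  exact fun j => ZMod.val_lt (z j)

/-- THE RESIDUAL OF A SOLUTION depends on `(F, c)` alone: force on the EL rows, `0` on the G/M rows, `c` on the Q rows.
[folklore] -/
def residOf (F c : Form1 (d + 1) ℝ) (y : AffineAveraging.Site (d + 1)) : Idx (d + 1) N → ℂ := fun i =>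
  match i with
  | Sum.inl (κ, z) => ((F κ (repZ z + (N : ℤ) • y) : ℝ) : ℂ)
  | Sum.inr (Sum.inl _) => 0
  | Sum.inr (Sum.inr κ) => ((c κ y : ℝ) : ℂ)

/-- The block residual of the configuration of a solution is `residOf F c`. [folklore] -/
theorem cfgFun_cfgOf_of_solvesKKT {F c A φ : Form1 (d + 1) ℝ} {μ : Form0 (d + 1) ℝ} (h : SolvesKKT N F c A φ μ)
    (y : AffineAveraging.Site (d + 1)) : cfgFun (shiftCfg (cfgOf (N := N) A φ μ) y) = residOf (N := N) F c y := by
  funext i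
  rcases i with ⟨κ, z⟩ | (z | κ)
  · rw [resid_cfgOf_inl, h.el]
    show _ = ((F κ (repZ z + (N : ℤ) • y) : ℝ) : ℂ)
    push_cast
    ring
  · rw [resid_cfgOf_inr_inl]
    show _ = (0 : ℂ)
    by_cases hz : z = 0
    · rw [if_pos hz, h.mean]
      push_cast
      rfl
    · rw [if_neg hz]
      have hg := h.gauge y (fun j => (z j).val) (repZ_mem_box z)
      rw [← repZ_eq_toSite, add_comm ((N : ℤ) • y) (repZ z)] at hg
      rw [hg, sub_self]
      push_cast
      rfl
  · rw [resid_cfgOf_inr_inr, h.avg]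
    rfl

/-- In block coordinates the KKT operator IS `FibreLiouville.stencilApply (stencil (d+1)) pieceMatrix`. [folklore] -/
theorem stencilApply_eq_cfgFun (U : Cfg (d + 1) N) (y : AffineAveraging.Site (d + 1)) :
    stencilApply (stencil (d + 1)) (pieceMatrix (N := N)) U y = cfgFun (shiftCfg U y) := by
  rw [cfgFun_shiftCfg_eq_sum]
  rfl

/-- Fine points of block `y` are at most `(1 + N(d+2))`-times farther than `y` (in the weight `1 + |·|₁`). [folklore] -/
theorem one_add_l1_fine_le (z : TorusSite (d + 1) N) (y : AffineAveraging.Site (d + 1)) :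
    1 + l1 (repZ z + (N : ℤ) • y) ≤ (1 + (N : ℝ) * (d + 2)) * (1 + l1 y) := by
  have h := l1_le_l1_quo (N := N) (repZ z + (N : ℤ) • y)
  rw [quo_add_zsmul, quo_repZ, zero_add] at h
  have hl : 0 ≤ l1 y := l1_nonneg y
  have e : (1 + (N : ℝ) * (d + 2)) * (1 + l1 y) - (1 + ((N : ℝ) * l1 y + (N : ℝ) * (d + 1)))
      = l1 y + N + N * (d + 1) * l1 y := by ring
  have hpos : 0 ≤ l1 y + N + N * (d + 1) * l1 y := by positivity
  linarith

/-- **TEMPERED TRIPLES GIVE POLYNOMIALLY BOUNDED CONFIGURATIONS.** [folklore] -/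
theorem polyBdd_cfgOf {A φ : Form1 (d + 1) ℝ} {μ : Form0 (d + 1) ℝ} (hA : Tempered1 A) (hφ : Tempered1 φ)
    (hμ : Tempered0 μ) : PolyBdd (cfgOf (N := N) A φ μ) := by
  obtain ⟨C₁, m₁, h₁⟩ := hA
  obtain ⟨C₂, m₂, h₂⟩ := hφ
  obtain ⟨C₃, m₃, h₃⟩ := hμ
  have hK1 : (1 : ℝ) ≤ 1 + (N : ℝ) * (d + 2) := by
    have : (0 : ℝ) ≤ (N : ℝ) * (d + 2) := by positivity
    linarith
  refine ⟨(|C₁| + |C₂| + |C₃|) * (1 + (N : ℝ) * (d + 2)) ^ (m₁ + m₂ + m₃), m₁ + m₂ + m₃, fun y i => ?_⟩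
  have hy : 1 ≤ 1 + l1 y := one_le_one_add_l1 y
  -- generic step: `C t^m ≤ |C| K^M (1 + |y|₁)^M` whenever `1 ≤ t ≤ K (1 + |y|₁)` and `m ≤ M`
  have key : ∀ (C : ℝ) (m : ℕ) (t : ℝ), m ≤ m₁ + m₂ + m₃ → 1 ≤ t → t ≤ (1 + (N : ℝ) * (d + 2)) * (1 + l1 y) →
      C * t ^ m ≤ |C| * ((1 + (N : ℝ) * (d + 2)) ^ (m₁ + m₂ + m₃) * (1 + l1 y) ^ (m₁ + m₂ + m₃)) := by
    intro C m t hm ht htK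
    calc C * t ^ m ≤ |C| * t ^ m := mul_le_mul_of_nonneg_right (le_abs_self C) (pow_nonneg (by linarith) _)
      _ ≤ |C| * ((1 + (N : ℝ) * (d + 2)) * (1 + l1 y)) ^ m :=
          mul_le_mul_of_nonneg_left (pow_le_pow_left₀ (by linarith) htK m) (abs_nonneg C)
      _ ≤ |C| * ((1 + (N : ℝ) * (d + 2)) * (1 + l1 y)) ^ (m₁ + m₂ + m₃) :=
          mul_le_mul_of_nonneg_left (pow_le_pow_right₀ (by nlinarith) hm) (abs_nonneg C)
      _ = |C| * ((1 + (N : ℝ) * (d + 2)) ^ (m₁ + m₂ + m₃) * (1 + l1 y) ^ (m₁ + m₂ + m₃)) := by rw [mul_pow]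
  have hX : 0 ≤ (1 + (N : ℝ) * (d + 2)) ^ (m₁ + m₂ + m₃) * (1 + l1 y) ^ (m₁ + m₂ + m₃) := by positivity
  have fin : ∀ C : ℝ, |C| ≤ |C₁| + |C₂| + |C₃| →
      |C| * ((1 + (N : ℝ) * (d + 2)) ^ (m₁ + m₂ + m₃) * (1 + l1 y) ^ (m₁ + m₂ + m₃))
        ≤ (|C₁| + |C₂| + |C₃|) * (1 + (N : ℝ) * (d + 2)) ^ (m₁ + m₂ + m₃) * (1 + l1 y) ^ (m₁ + m₂ + m₃) := by
    intro C hC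
    rw [mul_assoc]
    exact mul_le_mul_of_nonneg_right hC hX
  rcases i with ⟨κ, z⟩ | (z | κ)
  · rw [cfgOf_inl, Complex.norm_real, Real.norm_eq_abs]
    exact ((h₁ κ _).trans (key C₁ m₁ _ (by omega) (one_le_one_add_l1 _) (one_add_l1_fine_le z y))).trans
      (fin C₁ (by linarith [abs_nonneg C₂, abs_nonneg C₃]))
  · rw [cfgOf_inr_inl, Complex.norm_real, Real.norm_eq_abs]
    exact ((h₃ _).trans (key C₃ m₃ _ (by omega) (one_le_one_add_l1 _) (one_add_l1_fine_le z y))).trans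
      (fin C₃ (by linarith [abs_nonneg C₁, abs_nonneg C₂]))
  · rw [cfgOf_inr_inr, Complex.norm_real, Real.norm_eq_abs]
    exact ((h₂ κ y).trans (key C₂ m₂ _ (by omega) hy (by nlinarith))).trans
      (fin C₂ (by linarith [abs_nonneg C₁, abs_nonneg C₃]))

end Residual

/-! ## §4 Uniqueness of tempered solutions -/

section Unique

variable [NeZero N]

/-- **UNIQUENESS OF TEMPERED SOLUTIONS OF THE `U = 1` KKT SYSTEM**: two tempered triples solving the system with the same
force `F` and the same block averages `c` are equal. [folklore] -/
theorem unique_of_solvesKKT {F c A φ A' φ' : Form1 (d + 1) ℝ} {μ μ' : Form0 (d + 1) ℝ}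
    (h : SolvesKKT N F c A φ μ) (h' : SolvesKKT N F c A' φ' μ')
    (hA : Tempered1 A) (hφ : Tempered1 φ) (hμ : Tempered0 μ)
    (hA' : Tempered1 A') (hφ' : Tempered1 φ') (hμ' : Tempered0 μ') : A = A' ∧ φ = φ' ∧ μ = μ' := by
  have heq : stencilApply (stencil (d + 1)) (pieceMatrix (N := N)) (cfgOf (N := N) A φ μ)
      = stencilApply (stencil (d + 1)) (pieceMatrix (N := N)) (cfgOf (N := N) A' φ' μ') := by
    funext y
    rw [stencilApply_eq_cfgFun, stencilApply_eq_cfgFun, cfgFun_cfgOf_of_solvesKKT h, cfgFun_cfgOf_of_solvesKKT h']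
  exact eq_of_cfgOf_eq (eq_of_stencilApply_eq _ _ (fun s _ => det_trigPolySymbol_ne_zero s)
    (polyBdd_cfgOf hA hφ hμ) (polyBdd_cfgOf hA' hφ' hμ') heq)

end Unique

/-! ## §5 The fluctuation covariance kernel `Γ_N` is THE tempered solution with a unit force -/

section Gamma

variable [NeZero N]

/-- The column `(Γ(·, (l, x')), Φ(·, (l, x')), M(·, (l, x')))` of `Beta/KKTFluctuationKernel` solves the system with the
unit force at the bond `(l, x')` and zero block averages. [folklore] -/
theorem solvesKKT_Gam (l : Fin (d + 1)) (x' : AffineAveraging.Site (d + 1)) :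
    SolvesKKT N (delta1 l x') 0 (fun κ x => Gam (N := N) κ x l x') (fun κ q => GamΦ (N := N) κ q l x')
      (fun z => GamM (N := N) z l x') where
  el κ x := by rw [Gam_EL, delta1_apply]
  gauge := Gam_G l x'
  mean := GamM_M l x'
  avg κ y := by rw [Gam_Q]; rfl

/-- `Γ(·, (l, x'))` is bounded, hence tempered. [folklore] -/
theorem tempered_Gam (l : Fin (d + 1)) (x' : AffineAveraging.Site (d + 1)) :
    Tempered1 (fun κ x => Gam (N := N) κ x l x') := by
  obtain ⟨δ, C, hδ, hC, h⟩ := decay_Gam (N := N) (d := d)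
  refine Tempered1.of_bounded (B := C) fun κ x => (h κ x l x').trans ?_
  have : Real.exp (-δ * l1 (x - x')) ≤ 1 := by
    rw [Real.exp_le_one_iff]
    have := l1_nonneg (x - x')
    nlinarith
  nlinarith

/-- `Φ(·, (l, x'))` is bounded, hence tempered. [folklore] -/
theorem tempered_GamΦ (l : Fin (d + 1)) (x' : AffineAveraging.Site (d + 1)) :
    Tempered1 (fun κ q => GamΦ (N := N) κ q l x') := by
  obtain ⟨δ, C, hδ, hC, h⟩ := decay_wΓφ (N := N) (d := d)
  refine Tempered1.of_bounded (B := C) fun κ q => ?_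
  have hb := h l (Torus.proj N x') κ (q - quo N x')
  have : Real.exp (-δ * l1 (q - quo N x')) ≤ 1 := by
    rw [Real.exp_le_one_iff]
    have := l1_nonneg (q - quo N x')
    nlinarith
  calc |GamΦ (N := N) κ q l x'| = |wΓφ (N := N) l (Torus.proj N x') κ (q - quo N x')| := rfl
    _ ≤ C * Real.exp (-δ * l1 (q - quo N x')) := hb
    _ ≤ C := by nlinarith

/-- `M(·, (l, x'))` is bounded, hence tempered. [folklore] -/
theorem tempered_GamM (l : Fin (d + 1)) (x' : AffineAveraging.Site (d + 1)) :
    Tempered0 (fun z => GamM (N := N) z l x') := by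
  obtain ⟨δ, C, hδ, hC, h⟩ := decay_wΓμ (N := N) (d := d)
  refine Tempered0.of_bounded (B := C) fun z => ?_
  have hb := h l (Torus.proj N x') (z - (N : ℤ) • quo N x')
  have : Real.exp (-δ * l1 (z - (N : ℤ) • quo N x')) ≤ 1 := by
    rw [Real.exp_le_one_iff]
    have := l1_nonneg (z - (N : ℤ) • quo N x')
    nlinarith
  calc |GamM (N := N) z l x'| = |wΓμ (N := N) l (Torus.proj N x') (z - (N : ℤ) • quo N x')| := rfl
    _ ≤ C * Real.exp (-δ * l1 (z - (N : ℤ) • quo N x')) := hb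
    _ ≤ C := by nlinarith

/-- **THE FLUCTUATION COVARIANCE KERNEL IS CANONICAL**: every TEMPERED triple solving the `U = 1` KKT system with the unit
force at `(l, x')` and zero block averages is `(Γ(·, (l, x')), Φ(·, (l, x')), M(·, (l, x')))`. [folklore] -/
theorem eq_Gam_of_solvesKKT {l : Fin (d + 1)} {x' : AffineAveraging.Site (d + 1)} {A φ : Form1 (d + 1) ℝ}
    {μ : Form0 (d + 1) ℝ} (h : SolvesKKT N (delta1 l x') 0 A φ μ)
    (hA : Tempered1 A) (hφ : Tempered1 φ) (hμ : Tempered0 μ) :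
    A = (fun κ x => Gam (N := N) κ x l x') ∧ φ = (fun κ q => GamΦ (N := N) κ q l x')
      ∧ μ = (fun z => GamM (N := N) z l x') :=
  unique_of_solvesKKT h (solvesKKT_Gam l x') hA hφ hμ (tempered_Gam l x') (tempered_GamΦ l x') (tempered_GamM l x')

/-- In particular the fine field ALONE of any tempered solution is `Γ(·, (l, x'))`. [folklore] -/
theorem eq_Gam_of_solvesKKT' {l : Fin (d + 1)} {x' : AffineAveraging.Site (d + 1)} {A φ : Form1 (d + 1) ℝ}
    {μ : Form0 (d + 1) ℝ} (h : SolvesKKT N (delta1 l x') 0 A φ μ)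
    (hA : Tempered1 A) (hφ : Tempered1 φ) (hμ : Tempered0 μ) (κ : Fin (d + 1)) (x : AffineAveraging.Site (d + 1)) :
    A κ x = Gam (N := N) κ x l x' := by
  rw [(eq_Gam_of_solvesKKT h hA hφ hμ).1]

end Gamma

/-! ## §6 The minimiser columns `H_N` of `Beta/KernelSpecInstance` are THE tempered force-free solutions -/

section Minimiser

variable [NeZero N]

/-- The block-sum identity of the gauge multiplier of the minimiser column (read back from
`KKTFluctuationKernel.fundCfg_M`; not recorded in `Beta/KernelSpecInstance`). [folklore] -/
theorem wM_M (l : Fin (d + 1)) (y : AffineAveraging.Site (d + 1)) : blockSum N (wM (N := N) l) y = 0 := by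
  have h := fundCfg_M (N := N) (src l) y
  have h0 : (if y = 0 then src (N := N) l (Sum.inr (Sum.inl 0)) else 0) = 0 := by
    split_ifs <;> simp [src]
  rw [h0] at h
  have hre := congrArg Complex.re h
  simp only [blockSum, Complex.re_sum, Complex.zero_re] at hre ⊢
  exact hre

/-- The column `(wH(·, l, ·), wΦ(·, l, ·), wM l)` solves the force-free system with block averages `δ_{κ l} δ_{y 0}`.
[folklore] -/
theorem solvesKKT_wH (l : Fin (d + 1)) :
    SolvesKKT N 0 (fun κ y => if y = 0 ∧ κ = l then 1 else 0) (fun κ z => wH (N := N) κ l z)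
      (fun κ y => wΦ (N := N) κ l y) (wM (N := N) l) where
  el κ x := by rw [wH_EL]; simp
  gauge y b hb := wH_G l y hb
  mean := wM_M l
  avg κ y := wH_Q l κ y

/-- A `Decay510` field is bounded by its constant. [folklore] -/
theorem abs_le_of_decay510 {f : AffineAveraging.Site (d + 1) → ℝ} {C δ : ℝ} (hδ : 0 < δ) (h : Decay510 f C δ)
    (x : AffineAveraging.Site (d + 1)) : |f x| ≤ C := by
  have hx := h x
  have h1 : Real.exp (-δ * l1 x) ≤ 1 := by
    rw [Real.exp_le_one_iff]
    have := l1_nonneg x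
    nlinarith
  have hC : 0 ≤ C := by
    have := (abs_nonneg (f x)).trans hx
    have hpos := Real.exp_pos (-δ * l1 x)
    nlinarith
  nlinarith

/-- **THE MINIMISER COLUMNS ARE CANONICAL**: every TEMPERED triple solving the force-free `U = 1` KKT system with block
averages `δ_{κ l} δ_{y 0}` is the column `l` of `Beta/KernelSpecInstance`. [folklore] -/
theorem eq_wH_of_solvesKKT {l : Fin (d + 1)} {A φ : Form1 (d + 1) ℝ} {μ : Form0 (d + 1) ℝ}
    (h : SolvesKKT N 0 (fun κ y => if y = 0 ∧ κ = l then 1 else 0) A φ μ)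
    (hA : Tempered1 A) (hφ : Tempered1 φ) (hμ : Tempered0 μ) :
    A = (fun κ z => wH (N := N) κ l z) ∧ φ = (fun κ y => wΦ (N := N) κ l y) ∧ μ = wM (N := N) l := by
  obtain ⟨δ₁, C₁, hδ₁, h₁⟩ := decay_wH (N := N) (d := d)
  obtain ⟨δ₂, C₂, hδ₂, h₂⟩ := decay_wΦ (N := N) (d := d)
  obtain ⟨δ₃, C₃, hδ₃, h₃⟩ := decay_wM (N := N) (d := d)
  exact unique_of_solvesKKT h (solvesKKT_wH l) hA hφ hμ
    (Tempered1.of_bounded fun κ z => abs_le_of_decay510 hδ₁ (h₁ κ l) z)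
    (Tempered1.of_bounded fun κ y => abs_le_of_decay510 hδ₂ (h₂ κ l) y)
    (Tempered0.of_bounded fun z => abs_le_of_decay510 hδ₃ (h₃ l) z)

end Minimiser

end

end Literature.MathematicalPhysics.QuantumFieldTheory.Balaban1983to89.Beta.KKTFluctuationUnique
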